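import Mathlib
import HarnessLib
import Summits.NavierStokesRegularity.NavierStokesRegularity.Theorems.HalfSpaceWindowDoorCirculationCarryingRigidityConeFluxSubsolution
import Summits.NavierStokesRegularity.NavierStokesRegularity.Theorems.HalfSpaceWindowDoorCirculationCarryingRigidityAngularMeanDrift
import Literature.Analysis.FluidPDE.MeridianReduction

/-!
# Route `HalfSpaceWindowDoor`, crux `CirculationCarryingRigidity` (stmt-NavierStokesRegularity-25311) —
# line `eddy_covariance`, tools for the FLAT-record barrier: initial comparison, continuity of the comparison, drift norm, `⟪x, e_r⟫ = r`

LEAD ns-hsw-p1 g10, `--supports stmt-NavierStokesRegularity-25311 --as helper`; card `Cruxes/…/Lines/eddy_covariance.md`.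
Bookkeeping lemmas shared by the barrier files of the line (`…EddyBarrier`, `…FlatBarrier`), factored out to respect the 400-line limit:
`barrier_init` (at the initial time `s₀` the comparison `(2π)⁻¹(Γ − μ − A|x_h|²/(−s₀))` is `≤ 0`, from the class vorticity rate
`ω₃ ≤ (4K₁+1)/(−s)` and `Γ ≤ πr²·sup ω₃`), `continuousOn_comparison` (joint continuity of the comparison on the closed slab),
`norm_drift_le` (the norm of the drift `(p + m_r)e_r + (m_z + β)e_z`), `inner_self_eR` (`⟪x, e_r(x)⟫ = |x_h|`).
WHAT THIS IS NOT: not about NS regularity; kinematics/bookkeeping for HYPOTHETICAL blow-up profiles.  No item is closed by this file.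
-/

noncomputable section

-- the summit and its single sub-problem share the name (CONVENTIONS §1), as in every Theorems file
set_option linter.dupNamespace false

namespace Summit.NavierStokesRegularity.NavierStokesRegularity.Theorems.HalfSpaceWindowDoorCirculationCarryingRigidityFlatTools

open MeasureTheory Set Function Filter Topology InnerProductSpace
open scoped RealInnerProductSpace InnerProductSpace Laplacian
open Literature.Analysis Literature.Analysis.UnboundedOperators
open Literature.Analysis.FluidPDE hiding eR
open Summit.NavierStokesRegularity.NavierStokesRegularity.Theorems.HalfSpaceWindowDoorCirculationCarryingRigidityDefs
  (InDoorClass SignE3 e3)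
open Summit.NavierStokesRegularity.NavierStokesRegularity.Theorems.AxisTwistDoorAveragedConeLiouvilleDefs
  (cylPt eT eR circ vortCirc radVortCirc tiltCirc circleTerm meanR meanZ remainder)
open Summit.NavierStokesRegularity.NavierStokesRegularity.Theorems.AveragedConeLiouville.CircleStokes (continuous_eR)
open Summit.NavierStokesRegularity.NavierStokesRegularity.Theorems.AxisTwistDoorAveragedConeLiouvilleCylFrame
  (continuous_cylPt_θ abs_inner_eR_le abs_inner_e3_le abs_integral_le_const_mul_add norm_eR)
open Summit.NavierStokesRegularity.NavierStokesRegularity.Theorems.AveragedConeLiouville.CircleStokes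
  (deriv_circ_eq_vortCirc)
open Summit.NavierStokesRegularity.NavierStokesRegularity.Theorems.AveragedConeLiouville.CircleCalculus (deriv_circ_z)
open Summit.NavierStokesRegularity.NavierStokesRegularity.Theorems.AveragedConeLiouville.CircMonotone
  (circ_zero circ_mono circ_nonneg vortCirc_nonneg)
open Summit.NavierStokesRegularity.NavierStokesRegularity.Theorems.HalfSpaceWindowDoorCirculationCarryingRigidityAxisCirculation
  (contDiff_circF isSmoothSpaceTimeOn_circF isSmoothSpaceTimeOn_of_class fderiv_circF_eR laplacian_circF hasDerivAt_circF_time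
    contDiffOn_circ)
open Summit.NavierStokesRegularity.NavierStokesRegularity.Theorems.AxisTwistDoorAveragedConeLiouvilleAxisLift
  (lift gradient_lift contDiffAt_lift)

open Summit.NavierStokesRegularity.NavierStokesRegularity.Theorems.HalfSpaceWindowDoorCirculationCarryingRigidityConeFluxSubsolution


variable {C : ℝ} {v : ℝ → EuclideanSpace ℝ (Fin 3) → EuclideanSpace ℝ (Fin 3)}

/-- `⟪x, e_r(x)⟫ = |x_h|` off the axis (and trivially on it, both sides being `0`). -/
theorem inner_self_eR (x : EuclideanSpace ℝ (Fin 3)) : ⟪x, Literature.Analysis.FluidPDE.eR x⟫_ℝ = cylRadius x := by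
  by_cases hx : cylRadius x = 0
  · have h0 : Literature.Analysis.FluidPDE.eR x = 0 := by simp [Literature.Analysis.FluidPDE.eR, hx]
    rw [h0, inner_zero_right, hx]
  have hρ2 : cylRadius x ^ 2 = x 0 ^ 2 + x 1 ^ 2 := cylRadius_sq x
  have e : ⟪x, Literature.Analysis.FluidPDE.eR x⟫_ℝ = (cylRadius x)⁻¹ * (x 0 * x 0 + x 1 * x 1) := by
    simp [Literature.Analysis.FluidPDE.eR, EuclideanSpace.inner_eq_star_dotProduct, Fin.sum_univ_three, dotProduct]
    ring
  rw [e, show x 0 * x 0 + x 1 * x 1 = cylRadius x ^ 2 by rw [hρ2]; ring, pow_two, ← mul_assoc, inv_mul_cancel₀ hx, one_mul]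

/-- **Initial comparison**: at the time `s₀` the comparison `(2π)⁻¹(Γ(|x_h|,x₂,s₀) − μ − A(√(−s₀)√(−s₀))⁻¹|x_h|²)`, `A = π(4K₁+1)`, is
`≤ 0` for every `μ ≥ 0` (class vorticity rate `ω₃ ≤ (4K₁+1)/(−s₀)`, `Γ(r,z,s₀) ≤ πr²·(4K₁+1)/(−s₀)`). -/
theorem barrier_init (hv : InDoorClass C v) {K₁ : ℝ} (hK₁ : ∀ s < 0, ∀ x, ‖fderiv ℝ (v s) x‖ ≤ K₁ / (-s))
    {μ s₀ : ℝ} (hμ0 : 0 ≤ μ) (hs₀ : s₀ < 0) (x : EuclideanSpace ℝ (Fin 3)) :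
    (2 * Real.pi)⁻¹ * circ v (cylRadius x) (x 2) s₀ -
        (2 * Real.pi)⁻¹ * (μ + Real.pi * (4 * K₁ + 1) * (Real.sqrt (-s₀) * Real.sqrt (-s₀))⁻¹ * (x 0 * x 0 + x 1 * x 1)) ≤ 0 := by
  set ρ := cylRadius x with hρ
  have hρ0 : 0 ≤ ρ := cylRadius_nonneg x
  have hρ2 : ρ ^ 2 = x 0 * x 0 + x 1 * x 1 := by rw [cylRadius_sq x]; ring
  have hM : ∀ y, curl (v s₀) y 2 ≤ (4 * K₁ + 1) / (-s₀) := fun y => omega3_le_of_rate hK₁ hs₀ y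
  have h1 := circ_le_sq hv hs₀ hM hρ0 (x 2)
  have h2 : Real.pi * ρ ^ 2 * ((4 * K₁ + 1) / (-s₀)) =
      Real.pi * (4 * K₁ + 1) * (Real.sqrt (-s₀) * Real.sqrt (-s₀))⁻¹ * (x 0 * x 0 + x 1 * x 1) := by
    rw [Real.mul_self_sqrt (neg_pos.2 hs₀).le, ← hρ2]; field_simp
  rw [← mul_sub]
  refine mul_nonpos_of_nonneg_of_nonpos (by positivity) ?_
  have h3 := h1.trans_eq h2
  linarith

/-- **Joint continuity of the comparison** `(t,x) ↦ (2π)⁻¹Γ(|x_h|,x₂,t) − (2π)⁻¹(μ + A(√(−t)√(−s₀))⁻¹|x_h|²)` on `[s₀,s₁] × ℝ³`, `s₁ < 0`. -/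
theorem continuousOn_comparison (hv : InDoorClass C v) {μ A s₀ s₁ : ℝ} (hs₀₁ : s₀ < s₁) (hs₁ : s₁ < 0) :
    ContinuousOn (uncurry fun (t : ℝ) (x : EuclideanSpace ℝ (Fin 3)) =>
      (2 * Real.pi)⁻¹ * circ v (cylRadius x) (x 2) t -
        (2 * Real.pi)⁻¹ * (μ + A * (Real.sqrt (-t) * Real.sqrt (-s₀))⁻¹ * (x 0 * x 0 + x 1 * x 1))) (Icc s₀ s₁ ×ˢ univ) := by
  have hs₀ : s₀ < 0 := hs₀₁.trans hs₁
  have hsq₀ : 0 < Real.sqrt (-s₀) := Real.sqrt_pos.2 (neg_pos.2 hs₀)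
  have hsm := isSmoothSpaceTimeOn_of_class hv.1 hv.2.1 hv.2.2.1 hv.2.2.2
  have hsmF := isSmoothSpaceTimeOn_circF hsm
  have hFc : ContinuousOn (uncurry fun (t : ℝ) (x : EuclideanSpace ℝ (Fin 3)) => (2 * Real.pi)⁻¹ * circ v (cylRadius x) (x 2) t)
      (Icc s₀ s₁ ×ˢ univ) :=
    hsmF.continuousOn.mono (prod_mono (fun t ht => lt_of_le_of_lt ht.2 hs₁) Subset.rfl)
  have hcont_yi : ∀ i : Fin 3, Continuous fun y : EuclideanSpace ℝ (Fin 3) => y i := fun i =>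
    (continuous_apply i).comp (PiLp.continuous_ofLp 2 _)
  have hQ : Continuous fun p : ℝ × EuclideanSpace ℝ (Fin 3) => p.2 0 * p.2 0 + p.2 1 * p.2 1 :=
    (((hcont_yi 0).comp continuous_snd).mul ((hcont_yi 0).comp continuous_snd)).add
      (((hcont_yi 1).comp continuous_snd).mul ((hcont_yi 1).comp continuous_snd))
  have hinv : ContinuousOn (fun p : ℝ × EuclideanSpace ℝ (Fin 3) => (Real.sqrt (-p.1) * Real.sqrt (-s₀))⁻¹)
      (Icc s₀ s₁ ×ˢ univ) := by
    refine ContinuousOn.inv₀ ?_ fun p hp => ?_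
    · exact ((Real.continuous_sqrt.comp (continuous_neg.comp continuous_fst)).mul continuous_const).continuousOn
    · have ht : p.1 < 0 := lt_of_le_of_lt (mem_prod.1 hp).1.2 hs₁
      exact mul_ne_zero (Real.sqrt_pos.2 (neg_pos.2 ht)).ne' hsq₀.ne'
  have hφc : ContinuousOn (uncurry fun (t : ℝ) (x : EuclideanSpace ℝ (Fin 3)) =>
      (2 * Real.pi)⁻¹ * (μ + A * (Real.sqrt (-t) * Real.sqrt (-s₀))⁻¹ * (x 0 * x 0 + x 1 * x 1))) (Icc s₀ s₁ ×ˢ univ) :=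
    continuousOn_const.mul (continuousOn_const.add ((continuousOn_const.mul hinv).mul hQ.continuousOn))
  exact hFc.sub hφc

/-- **Norm of the drift** `(p + m_r) e_r(x) + (m_z + β) e_z`: `≤ L + c_r + (c_z + c_β)` if `‖p e_r(x)‖ ≤ L`, `|m_r| ≤ c_r`, `|m_z| ≤ c_z`,
`|β| ≤ c_β` (`‖e_r(x)‖ ≤ 1`, `‖e_z‖ = 1`). -/
theorem norm_drift_le (x : EuclideanSpace ℝ (Fin 3)) {p mR mZ β L cR cZ cβ : ℝ}
    (hp : ‖p • Literature.Analysis.FluidPDE.eR x‖ ≤ L) (hmR : |mR| ≤ cR) (hmZ : |mZ| ≤ cZ) (hβ : |β| ≤ cβ) :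
    ‖(p + mR) • Literature.Analysis.FluidPDE.eR x + (mZ + β) • (eZ : EuclideanSpace ℝ (Fin 3))‖ ≤ L + cR + (cZ + cβ) := by
  have hnR : ‖Literature.Analysis.FluidPDE.eR x‖ ≤ 1 := Literature.Analysis.FluidPDE.norm_eR_le_one x
  have hnZ : ‖(eZ : EuclideanSpace ℝ (Fin 3))‖ = 1 := by
    rw [EuclideanSpace.norm_eq]; simp [eZ]
  have hcR : 0 ≤ cR := (abs_nonneg _).trans hmR
  have e : (p + mR) • Literature.Analysis.FluidPDE.eR x + (mZ + β) • (eZ : EuclideanSpace ℝ (Fin 3)) =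
      p • Literature.Analysis.FluidPDE.eR x + (mR • Literature.Analysis.FluidPDE.eR x + (mZ + β) • (eZ : EuclideanSpace ℝ (Fin 3))) := by
    rw [add_smul]; abel
  rw [e]
  refine (norm_add_le _ _).trans ?_
  rw [add_assoc]
  refine add_le_add hp ((norm_add_le _ _).trans (add_le_add ?_ ?_))
  · rw [norm_smul, Real.norm_eq_abs]
    calc |mR| * ‖Literature.Analysis.FluidPDE.eR x‖ ≤ cR * 1 := mul_le_mul hmR hnR (norm_nonneg _) hcR
      _ = cR := mul_one _
  · rw [norm_smul, Real.norm_eq_abs, hnZ, mul_one]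
    exact (abs_add_le _ _).trans (add_le_add hmZ hβ)

/-! ### Pure-real bookkeeping of the flatness bounds at a touching point (appended, LEAD g10) -/

/-- **Radial flatness**: `(4πεE + 2κ)ρ ≤ ηρ/√(−t)` when `κ = A/(√(−t)√(−s₀))`, `4A ≤ η√(−s₀)`, `ε ≤ ε₀ ≤ η/(8πE₁√(−s₀))`, `E ≤ E₁`,
`s₀ ≤ t < 0` (so `2κ√(−t) ≤ η/2` and `4πεE√(−t) ≤ η/2`). -/
theorem flat_r_bound {A η s₀ t ε ε₀ E E₁ κ ρ : ℝ} (hρ0 : 0 ≤ ρ) (ht : t < 0) (hts₀ : s₀ ≤ t)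
    (hκ : κ = A * (Real.sqrt (-t) * Real.sqrt (-s₀))⁻¹) (hs₀η : 4 * A ≤ η * Real.sqrt (-s₀)) (hη : 0 < η)
    (hε : 0 ≤ ε) (hεε₀ : ε ≤ ε₀) (hE : 0 ≤ E) (hEE₁ : E ≤ E₁) (hE₁ : 0 < E₁)
    (hε₀1 : ε₀ ≤ η / (8 * Real.pi * E₁ * Real.sqrt (-s₀))) :
    (4 * Real.pi * ε * E + 2 * κ) * ρ ≤ η * ρ / Real.sqrt (-t) := by
  have hs₀ : s₀ < 0 := lt_of_le_of_lt hts₀ ht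
  have hsqt : 0 < Real.sqrt (-t) := Real.sqrt_pos.2 (neg_pos.2 ht)
  have hsq₀ : 0 < Real.sqrt (-s₀) := Real.sqrt_pos.2 (neg_pos.2 hs₀)
  have hst : Real.sqrt (-t) ≤ Real.sqrt (-s₀) := Real.sqrt_le_sqrt (by linarith)
  have hε₀0 : 0 ≤ ε₀ := hε.trans hεε₀
  rw [le_div_iff₀ hsqt]
  have hA1 : 2 * κ * Real.sqrt (-t) = 2 * A / Real.sqrt (-s₀) := by rw [hκ]; field_simp
  have hA2 : 2 * A / Real.sqrt (-s₀) ≤ η / 2 := by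
    rw [div_le_iff₀ hsq₀]
    have : η / 2 * Real.sqrt (-s₀) = (η * Real.sqrt (-s₀)) / 2 := by ring
    rw [this]; linarith
  have hB1 : 4 * Real.pi * ε * E * Real.sqrt (-t) ≤ η / 2 := by
    have h3 : 4 * Real.pi * ε * E * Real.sqrt (-t) ≤ 4 * Real.pi * ε₀ * E₁ * Real.sqrt (-s₀) := by
      have h31 : ε * E ≤ ε₀ * E₁ := mul_le_mul hεε₀ hEE₁ hE hε₀0
      have h32 : ε * E * Real.sqrt (-t) ≤ ε₀ * E₁ * Real.sqrt (-s₀) := mul_le_mul h31 hst hsqt.le (by positivity)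
      nlinarith [Real.pi_pos]
    have h5 : 4 * Real.pi * ε₀ * E₁ * Real.sqrt (-s₀) ≤ η / 2 := by
      have h51 := mul_le_mul_of_nonneg_left hε₀1 (by positivity : 0 ≤ 4 * Real.pi * E₁ * Real.sqrt (-s₀))
      have e : 4 * Real.pi * E₁ * Real.sqrt (-s₀) * (η / (8 * Real.pi * E₁ * Real.sqrt (-s₀))) = η / 2 := by
        field_simp; ring
      have e' : 4 * Real.pi * E₁ * Real.sqrt (-s₀) * ε₀ = 4 * Real.pi * ε₀ * E₁ * Real.sqrt (-s₀) := by ring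
      linarith [h51, e.le, e.ge, e'.le, e'.ge]
    linarith
  have e : (4 * Real.pi * ε * E + 2 * κ) * ρ * Real.sqrt (-t) =
      (4 * Real.pi * ε * E * Real.sqrt (-t) + 2 * κ * Real.sqrt (-t)) * ρ := by ring
  rw [e]
  have : 4 * Real.pi * ε * E * Real.sqrt (-t) + 2 * κ * Real.sqrt (-t) ≤ η := by rw [hA1]; linarith
  exact mul_le_mul_of_nonneg_right this hρ0

/-- **Vertical flatness**: `4πεE|x₂| ≤ ηρ/√(−t)` when `|x₂| ≤ n`, `ε(1 + n²) ≤ B_up`, `ε ≤ ε₀ ≤ η²/(16π²E₁²(B_up+1))`, `E ≤ E₁`, and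
`ρ ≥ √(−t)` (so `4πE₁·ε n ≤ 4πE₁√(ε₀(B_up+1)) ≤ η`). -/
theorem flat_z_bound {η t ε ε₀ E E₁ ρ n x₂ Bup : ℝ} (ht : t < 0) (hη : 0 < η) (hn : 0 ≤ n) (hx₂ : |x₂| ≤ n)
    (hε : 0 ≤ ε) (hεε₀ : ε ≤ ε₀) (hεq : ε * (1 + n ^ 2) ≤ Bup) (hBup0 : 0 ≤ Bup)
    (hE : 0 ≤ E) (hEE₁ : E ≤ E₁) (hE₁ : 0 < E₁)
    (hε₀2 : ε₀ ≤ η ^ 2 / (16 * Real.pi ^ 2 * E₁ ^ 2 * (Bup + 1))) (hρσ : Real.sqrt (-t) ≤ ρ) :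
    4 * Real.pi * ε * E * |x₂| ≤ η * ρ / Real.sqrt (-t) := by
  have hsqt : 0 < Real.sqrt (-t) := Real.sqrt_pos.2 (neg_pos.2 ht)
  have hε₀0 : 0 ≤ ε₀ := hε.trans hεε₀
  have hεx : (ε * n) ^ 2 ≤ ε₀ * (Bup + 1) := by
    have h3 : ε * n ^ 2 ≤ Bup := by nlinarith
    calc (ε * n) ^ 2 = ε * (ε * n ^ 2) := by ring
      _ ≤ ε₀ * (Bup + 1) := mul_le_mul hεε₀ (by linarith) (by positivity) hε₀0
  have hεx' : ε * n ≤ Real.sqrt (ε₀ * (Bup + 1)) := by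
    rw [← Real.sqrt_sq (by positivity : 0 ≤ ε * n)]
    exact Real.sqrt_le_sqrt hεx
  have hroot : 4 * Real.pi * E₁ * Real.sqrt (ε₀ * (Bup + 1)) ≤ η := by
    have h5 : ε₀ * (Bup + 1) ≤ η ^ 2 / (16 * Real.pi ^ 2 * E₁ ^ 2) := by
      have := mul_le_mul_of_nonneg_right hε₀2 (by positivity : 0 ≤ Bup + 1)
      refine this.trans (le_of_eq ?_)
      field_simp
    have h6 : Real.sqrt (ε₀ * (Bup + 1)) ≤ η / (4 * Real.pi * E₁) := by
      rw [← Real.sqrt_sq (by positivity : 0 ≤ η / (4 * Real.pi * E₁))]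
      refine Real.sqrt_le_sqrt (h5.trans (le_of_eq ?_))
      rw [div_pow, mul_pow, mul_pow]
      norm_num
    calc 4 * Real.pi * E₁ * Real.sqrt (ε₀ * (Bup + 1)) ≤ 4 * Real.pi * E₁ * (η / (4 * Real.pi * E₁)) :=
          mul_le_mul_of_nonneg_left h6 (by positivity)
      _ = η := by field_simp
  have hρσ' : 1 ≤ ρ / Real.sqrt (-t) := by rw [le_div_iff₀ hsqt, one_mul]; exact hρσ
  calc 4 * Real.pi * ε * E * |x₂| ≤ 4 * Real.pi * ε * E * n := mul_le_mul_of_nonneg_left hx₂ (by positivity)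
    _ = 4 * Real.pi * E * (ε * n) := by ring
    _ ≤ 4 * Real.pi * E₁ * (ε * n) := by
        have : 0 ≤ ε * n := by positivity
        exact mul_le_mul_of_nonneg_right (mul_le_mul_of_nonneg_left hEE₁ (by positivity)) this
    _ ≤ 4 * Real.pi * E₁ * Real.sqrt (ε₀ * (Bup + 1)) := mul_le_mul_of_nonneg_left hεx' (by positivity)
    _ ≤ η := hroot
    _ ≤ η * (ρ / Real.sqrt (-t)) := le_mul_of_one_le_right hη.le hρσ'
    _ = η * ρ / Real.sqrt (-t) := by ring

/-! ### Second appendix (LEAD g10): barrier slack, and the local-maximality bound at a penalised maximum -/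

/-- **Barrier slack**: `0 ≤ (2π)⁻¹(A·D·X) + (2π)⁻¹κ(2/ρ − B'/√(−t))(2ρ) − (2π)⁻¹·4κ` when `A·D = κ/(2(−t))`, `X = ρ²`, `ρ ≥ 4B'√(−t)`:
the quadratic barrier `μ + κ|x_h|²` (with `∂ₜκ = κ/(2(−t))`) beats a radial inward drift of speed `B'/√(−t)` outside the tube `4B'√(−t)`. -/
theorem barrier_slack_nonneg {A D κ ρ t B' X : ℝ} (ht : t < 0) (hκ0 : 0 ≤ κ) (hρ : 0 < ρ) (hX : X = ρ ^ 2)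
    (hAD : A * D = κ / (2 * (-t))) (hρ4 : 4 * B' * Real.sqrt (-t) ≤ ρ) :
    0 ≤ (2 * Real.pi)⁻¹ * (A * D * X) + (2 * Real.pi)⁻¹ * (κ * ((2 / ρ - B' / Real.sqrt (-t)) * (2 * ρ))) -
      (2 * Real.pi)⁻¹ * (κ * 4) := by
  have hsqt : 0 < Real.sqrt (-t) := Real.sqrt_pos.2 (neg_pos.2 ht)
  rw [hX, show A * D * ρ ^ 2 = (A * D) * ρ ^ 2 by ring, hAD]
  have htt : Real.sqrt (-t) ^ 2 = -t := Real.sq_sqrt (neg_pos.2 ht).le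
  set σ : ℝ := Real.sqrt (-t) with hσ
  have e0 : (2 / ρ - B' / σ) * (2 * ρ) = 4 - 2 * B' * ρ / σ := by
    field_simp
    ring
  rw [e0, ← htt]
  have e1 : (2 * Real.pi)⁻¹ * (κ / (2 * σ ^ 2) * ρ ^ 2) + (2 * Real.pi)⁻¹ * (κ * (4 - 2 * B' * ρ / σ))
      - (2 * Real.pi)⁻¹ * (κ * 4) = (2 * Real.pi)⁻¹ * κ * (ρ / σ) * ((ρ - 4 * B' * σ) / (2 * σ)) := by
    field_simp
    ring
  rw [e1]
  have h4 : 0 ≤ (ρ - 4 * B' * σ) / (2 * σ) := div_nonneg (by linarith) (by positivity)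
  have : 0 ≤ ρ / σ := by positivity
  exact mul_nonneg (mul_nonneg (mul_nonneg (by positivity) hκ0) this) h4

/-- Monotonicity of the barrier's drift pairing in the radial speed: `p ≤ a ⇒ (2π)⁻¹κ(p·2ρ) ≤ (2π)⁻¹κ(a·2ρ)` (`κ, ρ ≥ 0`). -/
theorem barrier_drift_mono {κ ρ p a : ℝ} (hκ0 : 0 ≤ κ) (hρ : 0 ≤ ρ) (hpa : p ≤ a) :
    (2 * Real.pi)⁻¹ * (κ * (p * (2 * ρ))) ≤ (2 * Real.pi)⁻¹ * (κ * (a * (2 * ρ))) :=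
  mul_le_mul_of_nonneg_left (mul_le_mul_of_nonneg_left (mul_le_mul_of_nonneg_right hpa (by positivity)) hκ0) (by positivity)

/-- **The small constants at a touching point**: `2κ√(−t) ≤ η/2` and `4πεE√(−t) ≤ η/2` (as in `flat_r_bound`). -/
theorem touch_consts {A η s₀ t ε ε₀ E E₁ κ : ℝ} (ht : t < 0) (hts₀ : s₀ ≤ t)
    (hκ : κ = A * (Real.sqrt (-t) * Real.sqrt (-s₀))⁻¹) (hs₀η : 4 * A ≤ η * Real.sqrt (-s₀))
    (hε : 0 ≤ ε) (hεε₀ : ε ≤ ε₀) (hE : 0 ≤ E) (hEE₁ : E ≤ E₁) (hE₁ : 0 < E₁)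
    (hε₀1 : ε₀ ≤ η / (8 * Real.pi * E₁ * Real.sqrt (-s₀))) :
    2 * κ * Real.sqrt (-t) ≤ η / 2 ∧ 4 * Real.pi * ε * E * Real.sqrt (-t) ≤ η / 2 := by
  have hs₀ : s₀ < 0 := lt_of_le_of_lt hts₀ ht
  have hsqt : 0 < Real.sqrt (-t) := Real.sqrt_pos.2 (neg_pos.2 ht)
  have hsq₀ : 0 < Real.sqrt (-s₀) := Real.sqrt_pos.2 (neg_pos.2 hs₀)
  have hst : Real.sqrt (-t) ≤ Real.sqrt (-s₀) := Real.sqrt_le_sqrt (by linarith)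
  have hε₀0 : 0 ≤ ε₀ := hε.trans hεε₀
  constructor
  · have hA1 : 2 * κ * Real.sqrt (-t) = 2 * A / Real.sqrt (-s₀) := by rw [hκ]; field_simp
    rw [hA1, div_le_iff₀ hsq₀]
    have : η / 2 * Real.sqrt (-s₀) = (η * Real.sqrt (-s₀)) / 2 := by ring
    rw [this]; linarith
  · have h31 : ε * E ≤ ε₀ * E₁ := mul_le_mul hεε₀ hEE₁ hE hε₀0
    have h32 : ε * E * Real.sqrt (-t) ≤ ε₀ * E₁ * Real.sqrt (-s₀) := mul_le_mul h31 hst hsqt.le (by positivity)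
    have h51 := mul_le_mul_of_nonneg_left hε₀1 (by positivity : 0 ≤ 4 * Real.pi * E₁ * Real.sqrt (-s₀))
    have e : 4 * Real.pi * E₁ * Real.sqrt (-s₀) * (η / (8 * Real.pi * E₁ * Real.sqrt (-s₀))) = η / 2 := by
      field_simp; ring
    nlinarith [Real.pi_pos, h32, h51, e.le, e.ge]

/-- **The vertical constant at a touching point**: `4πεE|x₂| ≤ η` (as in `flat_z_bound`). -/
theorem touch_z_const {η ε ε₀ E E₁ n x₂ Bup : ℝ} (hη : 0 < η) (hn : 0 ≤ n) (hx₂ : |x₂| ≤ n)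
    (hε : 0 ≤ ε) (hεε₀ : ε ≤ ε₀) (hεq : ε * (1 + n ^ 2) ≤ Bup) (hBup0 : 0 ≤ Bup)
    (hE : 0 ≤ E) (hEE₁ : E ≤ E₁) (hE₁ : 0 < E₁)
    (hε₀2 : ε₀ ≤ η ^ 2 / (16 * Real.pi ^ 2 * E₁ ^ 2 * (Bup + 1))) :
    4 * Real.pi * ε * E * |x₂| ≤ η := by
  have h := flat_z_bound (t := -1) (ρ := Real.sqrt (-(-1 : ℝ))) (by norm_num) hη hn hx₂ hε hεε₀ hεq hBup0 hE hEE₁ hE₁ hε₀2 le_rfl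
  have h1 : Real.sqrt (-(-1 : ℝ)) = 1 := by norm_num
  rw [h1] at h
  simpa using h

/-- **Local maximality at a penalised maximum.**  If the penalised comparison `(2π)⁻¹(Γ − μ − κr²) − εE(1 + r² + z²)` at the circle
`(r', z')` does not exceed its value at `(ρ, x₂)`, with `r' ≤ 2ρ`, `|z' − x₂| ≤ ρ`, `ρ ≥ √(−t)` and the touching constants
`2κ√(−t) ≤ η/2`, `4πεE√(−t) ≤ η/2`, `4πεE|x₂| ≤ η`, then `Γ' ≤ Γ + 3ηρ²/√(−t)`. -/
theorem locmax_bound {Γ Γ' μ κ ε E r' z' ρ x₂ η t : ℝ} (ht : t < 0) (hη : 0 < η) (hκ0 : 0 ≤ κ) (hε : 0 ≤ ε) (hE : 0 ≤ E)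
    (hρ : Real.sqrt (-t) ≤ ρ) (hr' : 0 ≤ r') (hr'2 : r' ≤ 2 * ρ) (hz' : |z' - x₂| ≤ ρ)
    (hineq : (2 * Real.pi)⁻¹ * (Γ' - (μ + κ * (r' ^ 2))) - ε * (E * (1 + (r' ^ 2 + z' ^ 2))) ≤
      (2 * Real.pi)⁻¹ * (Γ - (μ + κ * (ρ ^ 2))) - ε * (E * (1 + (ρ ^ 2 + x₂ ^ 2))))
    (hκ2 : 2 * κ * Real.sqrt (-t) ≤ η / 2) (hεE : 4 * Real.pi * ε * E * Real.sqrt (-t) ≤ η / 2)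
    (hz : 4 * Real.pi * ε * E * |x₂| ≤ η) :
    Γ' ≤ Γ + 3 * η * ρ ^ 2 / Real.sqrt (-t) := by
  have hsqt : 0 < Real.sqrt (-t) := Real.sqrt_pos.2 (neg_pos.2 ht)
  have hρ0 : 0 < ρ := hsqt.trans_le hρ
  have h2π : 0 < 2 * Real.pi := by positivity
  -- clear the `(2π)⁻¹`
  have h1 : Γ' ≤ Γ + κ * (r' ^ 2 - ρ ^ 2) + 2 * Real.pi * (ε * E) * (r' ^ 2 - ρ ^ 2 + (z' ^ 2 - x₂ ^ 2)) := by
    have h0 := mul_le_mul_of_nonneg_left hineq h2π.le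
    have e1 : 2 * Real.pi * ((2 * Real.pi)⁻¹ * (Γ' - (μ + κ * (r' ^ 2))) - ε * (E * (1 + (r' ^ 2 + z' ^ 2)))) =
        Γ' - (μ + κ * r' ^ 2) - 2 * Real.pi * (ε * E) * (1 + (r' ^ 2 + z' ^ 2)) := by
      field_simp
    have e2 : 2 * Real.pi * ((2 * Real.pi)⁻¹ * (Γ - (μ + κ * (ρ ^ 2))) - ε * (E * (1 + (ρ ^ 2 + x₂ ^ 2)))) =
        Γ - (μ + κ * ρ ^ 2) - 2 * Real.pi * (ε * E) * (1 + (ρ ^ 2 + x₂ ^ 2)) := by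
      field_simp
    rw [e1, e2] at h0
    linarith
  -- the three increments
  have hsq : r' ^ 2 ≤ 4 * ρ ^ 2 := by nlinarith [hr', hr'2]
  have hA : κ * (r' ^ 2 - ρ ^ 2) ≤ 3 / 4 * η * ρ ^ 2 / Real.sqrt (-t) := by
    have hk : κ ≤ η / (4 * Real.sqrt (-t)) := by
      rw [le_div_iff₀ (by positivity)]; linarith
    calc κ * (r' ^ 2 - ρ ^ 2) ≤ κ * (3 * ρ ^ 2) := mul_le_mul_of_nonneg_left (by linarith) hκ0
      _ ≤ η / (4 * Real.sqrt (-t)) * (3 * ρ ^ 2) := mul_le_mul_of_nonneg_right hk (by positivity)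
      _ = 3 / 4 * η * ρ ^ 2 / Real.sqrt (-t) := by field_simp
  have hzz : z' ^ 2 - x₂ ^ 2 ≤ ρ ^ 2 + 2 * |x₂| * ρ := by
    have hd := hz'
    have e : z' ^ 2 - x₂ ^ 2 = (z' - x₂) ^ 2 + 2 * x₂ * (z' - x₂) := by ring
    rw [e]
    have h3 : (z' - x₂) ^ 2 ≤ ρ ^ 2 := by
      have := abs_le.1 hd
      nlinarith [this.1, this.2]
    have h4 : 2 * x₂ * (z' - x₂) ≤ 2 * |x₂| * ρ := by
      calc 2 * x₂ * (z' - x₂) ≤ |2 * x₂ * (z' - x₂)| := le_abs_self _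
        _ = 2 * |x₂| * |z' - x₂| := by rw [abs_mul, abs_mul, abs_two]
        _ ≤ 2 * |x₂| * ρ := mul_le_mul_of_nonneg_left hd (by positivity)
    linarith
  have hεE' : 2 * Real.pi * (ε * E) ≤ η / (4 * Real.sqrt (-t)) := by
    rw [le_div_iff₀ (by positivity)]; linarith
  have hB : 2 * Real.pi * (ε * E) * (r' ^ 2 - ρ ^ 2 + (z' ^ 2 - x₂ ^ 2)) ≤
      η / (4 * Real.sqrt (-t)) * (4 * ρ ^ 2) + η * ρ := by
    have hinc : r' ^ 2 - ρ ^ 2 + (z' ^ 2 - x₂ ^ 2) ≤ 4 * ρ ^ 2 + 2 * |x₂| * ρ := by linarith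
    calc 2 * Real.pi * (ε * E) * (r' ^ 2 - ρ ^ 2 + (z' ^ 2 - x₂ ^ 2))
        ≤ 2 * Real.pi * (ε * E) * (4 * ρ ^ 2 + 2 * |x₂| * ρ) := mul_le_mul_of_nonneg_left hinc (by positivity)
      _ = 2 * Real.pi * (ε * E) * (4 * ρ ^ 2) + (4 * Real.pi * ε * E * |x₂|) * ρ := by ring
      _ ≤ η / (4 * Real.sqrt (-t)) * (4 * ρ ^ 2) + η * ρ :=
          add_le_add (mul_le_mul_of_nonneg_right hεE' (by positivity)) (mul_le_mul_of_nonneg_right hz hρ0.le)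
  have hC : η * ρ ≤ η * ρ ^ 2 / Real.sqrt (-t) := by
    rw [le_div_iff₀ hsqt]
    have : η * ρ * Real.sqrt (-t) ≤ η * ρ * ρ := mul_le_mul_of_nonneg_left hρ (by positivity)
    calc η * ρ * Real.sqrt (-t) ≤ η * ρ * ρ := this
      _ = η * ρ ^ 2 := by ring
  have e4 : η / (4 * Real.sqrt (-t)) * (4 * ρ ^ 2) = η * ρ ^ 2 / Real.sqrt (-t) := by field_simp
  rw [e4] at hB
  have etot : 3 / 4 * η * ρ ^ 2 / Real.sqrt (-t) + (η * ρ ^ 2 / Real.sqrt (-t) + η * ρ ^ 2 / Real.sqrt (-t)) ≤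
      3 * η * ρ ^ 2 / Real.sqrt (-t) := by
    rw [← add_div, ← add_div, div_le_div_iff_of_pos_right hsqt]
    have : 0 ≤ η * ρ ^ 2 := by positivity
    linarith
  linarith [h1, hA, hB, hC, etot]

/-! ### Third appendix (LEAD g10): far circles from a positive comparison, the sign multiplier, coordinates of `cylPt r 0 z` -/

/-- **A positive comparison lives outside the tube.**  If `(2π)⁻¹Γ(|x_h|,x₂,t) − (2π)⁻¹(μ + κ|x_h|²) > 0` with `κ ≥ 0` and the tube-boundary
circulation at this height is `≤ μ`, then `|x_h| > R₁√(−t)` (radial monotonicity of `Γ`). -/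
theorem far_of_comparison_pos (hv : InDoorClass C v) (hsign : SignE3 v) {t : ℝ} (ht : t < 0) {x : EuclideanSpace ℝ (Fin 3)}
    {μ κ R₁ : ℝ} (hκ0 : 0 ≤ κ) (hμ' : circ v (R₁ * Real.sqrt (-t)) (x 2) t ≤ μ)
    (hq : 0 < (2 * Real.pi)⁻¹ * circ v (cylRadius x) (x 2) t - (2 * Real.pi)⁻¹ * (μ + κ * (x 0 * x 0 + x 1 * x 1))) :
    R₁ * Real.sqrt (-t) < cylRadius x := by
  by_contra hle
  push Not at hle
  have hv1 := contDiff_one_slice hv ht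
  have hρ2 : cylRadius x ^ 2 = x 0 * x 0 + x 1 * x 1 := by rw [cylRadius_sq x]; ring
  have hmono := circ_mono v hv1 (signE3_atd hsign) ht (cylRadius_nonneg x) hle (x 2)
  have hQ0 : 0 ≤ κ * (x 0 * x 0 + x 1 * x 1) := by rw [← hρ2]; positivity
  have : (2 * Real.pi)⁻¹ * circ v (cylRadius x) (x 2) t - (2 * Real.pi)⁻¹ * (μ + κ * (x 0 * x 0 + x 1 * x 1)) ≤ 0 := by
    rw [← mul_sub]
    exact mul_nonpos_of_nonneg_of_nonpos (by positivity) (by linarith)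
  linarith

/-- **The sign multiplier** `β = ±b` (`b ≥ 0`) following the sign of `ϱ`: `|β| = b` and `βϱ = b|ϱ|`. -/
theorem sign_mult {b ϱ : ℝ} (hb : 0 ≤ b) :
    |(if 0 ≤ ϱ then b else -b)| = b ∧ (if 0 ≤ ϱ then b else -b) * ϱ = b * |ϱ| := by
  split_ifs with h
  · exact ⟨abs_of_nonneg hb, by rw [abs_of_nonneg h]⟩
  · push Not at h
    exact ⟨by rw [abs_neg, abs_of_nonneg hb], by rw [abs_of_neg h]; ring⟩

/-- Cylindrical bookkeeping of the point `cylPt r 0 z` (`r ≥ 0`): radius `r`, height `z`, `y₀² + y₁² = r²`, `‖y‖² = r² + z²`. -/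
theorem cylPt_zero_data {r : ℝ} (hr : 0 ≤ r) (z : ℝ) :
    cylRadius (cylPt r 0 z) = r ∧ (cylPt r 0 z) 2 = z ∧
      (cylPt r 0 z) 0 * (cylPt r 0 z) 0 + (cylPt r 0 z) 1 * (cylPt r 0 z) 1 = r ^ 2 ∧ ‖cylPt r 0 z‖ ^ 2 = r ^ 2 + z ^ 2 := by
  refine ⟨by rw [cylRadius]; simp [cylPt, Real.sqrt_sq hr], by simp [cylPt], by simp [cylPt]; ring, ?_⟩
  rw [EuclideanSpace.norm_eq, Real.sq_sqrt (Finset.sum_nonneg fun i _ => sq_nonneg _), Fin.sum_univ_three]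
  simp [cylPt]

end Summit.NavierStokesRegularity.NavierStokesRegularity.Theorems.HalfSpaceWindowDoorCirculationCarryingRigidityFlatTools

end
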